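import Mathlib.Algebra.BigOperators.Fin
import Mathlib.Algebra.BigOperators.Pi
import Mathlib.Data.ZMod.Basic
import Mathlib.Data.Matrix.Mul
import Mathlib.LinearAlgebra.Dimension.Constructions
import Mathlib.Tactic.FinCases
import Mathlib.Tactic.Ring

/-!
# Dodecic atlas, type `ℤ/6 × ℤ/2`: the cyclotomic CM fields `ℚ(ζ₂₁)`, `ℚ(ζ₂₈)`, `ℚ(ζ₃₆)` and all Galois CM fields with this group — the Hodge lattice of the whole `F`-slice, its two Weil orbits and five atoms (kernel census)

COR-CM (cell `pub-hodgecm2`), count-neutral kernel census by the binder seat b17 (gen 39; claim C62-KERNEL, third row of the order-12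
table after `Census/DodecicDicyclicSpecies.lean` (`Dic₃`) and `Census/DodecicCyclicSpecies.lean` (`ℤ/12`)): the kernel certificate of the
`ℤ/6 × ℤ/2` row of the cell memos `HOME/pub-hodgecm2-lit-andre-3/PORTFOLIO-lit-andre-3-g8.md` (μ(ℤ/6×ℤ/2) = 5 "mod hW4", exact) and
`HOME/pub-hodgecm2-b17/dic3/ORDER12-CARRIERS.md` (b17 gen 38: minimal carrier profile `(13,13,12,9,9)`).  Differences from the two earlier
rows: the simple factors are HETEROGENEOUS (two CM elliptic curves, two CM threefolds, four CM sixfolds), a "Markman" sublattice of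
classes on carriers of dimension `≤ 5` enters (the Weil classes of the two fourfolds `E × T`), and the minimality `μ ≥ 5` is NOT seen
by block parities (they give `4`): it is an `𝔽₄`-obstruction, proved in the sequel `Census/DodecicC6C2Minimality.lean`.  The lattice
theorem is `Census/DodecicC6C2Lattice.lean`.  No named fact, no geometry, no `sorry`: `decide`, `simp`, `omega` only in this file.
HC_CM is not proved anywhere in this cell; nothing here is a headline.

DICTIONARY (cited, not formalised; as in `Census/OcticQuaternionSpecies.lean`): `F` Galois CM, `G = Gal(F/ℚ) = Hom(F, ℚ̄)`, `c ∈ Z(G)`;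
CM types `T ⊔ cT = G`; simple CM abelian varieties split by `F` ↔ translation orbits of CM types, stabiliser `H_T` ↔ CM field `F^{H_T}`,
`dim = |G|/2|H_T|`, eigen-labels `G/H_T` [cite: Milne1999, Prop. 2.1 and the paragraph after it, p. 54]; Hodge monomials ⟺ all Pohlmann
forms vanish [cite: Pohlmann1968, Thm 1]; conjugate pairs = divisor classes.

THIS TYPE.  `G = ℤ/6 × ℤ/2` (additive), `c = (0,1)`; e.g. `ℚ(ζ₂₁)`, `ℚ(ζ₂₈)`, `ℚ(ζ₃₆)` (`(ℤ/N)ˣ ≅ ℤ/6 × ℤ/2`, `c = −1`).  CM subfields: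
the two imaginary quadratic fields `k₀ = F^{ℤ/6×0}`, `k₁ = F^{⟨(1,1)⟩}`, the two sextic CM fields `K₀ = F^{⟨(3,1)⟩}`, `K₁ = F^{⟨(3,0)⟩}`
(cyclic sextic), and `F`.  `types_census`: `64` CM types = `2 + 2` (ELLIPTIC CURVES `E₀, E₁` with CM by `k₀, k₁`) `+ 6 + 6` (THREEFOLDS
`T₀, T₁` with CM by `K₀, K₁`) `+ 4·12` (SIXFOLDS `B₀, …, B₃` with CM by `F`).  Labels (`Pt`, 64): `e j u` (`u ∈ ℤ/2`), `t j u` (`u ∈ ℤ/6`),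
`q j g` (`g ∈ G`); the Galois action is translation through the quotient maps `epsE j`, `epsT j` (`labels_census`).  The slice is the
family of all `E₀^{a₀} × E₁^{a₁} × T₀^{b₀} × T₁^{b₁} × ∏ B_j^{n_j}`; for `ℚ(ζ₂₁)`, `ℚ(ζ₂₈)`, `ℚ(ζ₃₆)`: `k₀, k₁ ∈ {ℚ(√−3), ℚ(√−7)}`,
`{ℚ(√−1), ℚ(√−7)}`, `{ℚ(√−1), ℚ(√−3)}`.
NUMBERS (exact oracle `dic3k/c62model.py` = b17 g38 `dic3/gmodel.py`): Pohlmann forms of rank `6`, Hodge lattice `H` of rank `58`, `32`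
conjugate pairs (`P`); Hodge monomials on carriers of dimension `≤ 5` outside `P`: `12`, spanning with `P` a lattice of rank `34` = `P` +
the translates of the TWO Weil orbits `mkRep` (`E₁ × T₀` and `E₀ × T₁`, Künneth `(1,3)`, orbits of size `2`: the `k`-Weil planes of two CM
abelian FOURFOLDS of Weil type — algebraic by `Markman2025_weilClasses_algebraic_abelianFourfold` / the cell's
`CMWeights.hodgeConjectureFor_of_isOfCMType_dim_le_five_of_markman`, NOT used in this file); `M = H/(P + Mk)` of rank `24`, generated by
FIVE more orbits and no fewer.  NEIGHBOURS (cited by name, not imported): b04 `CorCM/CyclotomicRankTable{TwentyOne,TwentyEight,ThirtySix}`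
/ `CyclotomicRankCensusDegreeTwelve*` (Kubota ranks of the 48 primitive types: 24 nondegenerate, 24 degenerate — powers of the simple
sixfolds), b30 `Census/DuodecicFaceSquares*` (rank-four face squares), lit-andre-3's octic/decic atlas (method).

KERNEL, THIS FILE.  `types_census`, `labels_census`, `sanity` · `hodgeLattice`, `mem_hodgeLattice` · `pairs` (`P`), `markman` (`Mk` =
translates of `mkRep 0, 1`), `atoms` (`A` = translates of `orbitRep 0, …, 4`) · `mk_census`, `atom_census` (Künneth types over the eight
blocks `E₀,E₁,T₀,T₁,B₀,…,B₃`; carriers `E₁ × B₀ × B₂` (13), `E₀ × B₂ × B₃` (13), `B₁ × B₂` (12), `T₁ × B₁` (9), `T₀ × B₃` (9) = the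
lexicographically minimal profile `(13,13,12,9,9)`, exhaustive oracle ORDER12-CARRIERS / kit job j131589, not re-decided here; orbit
sizes) · `pairs_le`, `markman_le`, `atoms_le` (`P, Mk, A ≤ H`).  SEQUELS: `…Lattice.lean`: **`hodgeLattice = pairs ⊔ markman ⊔ atoms`**;
`…Minimality.lean`: **every finite `S` with `H ≤ P ⊔ Mk ⊔ Σ_{t∈S} ℤ[G]·t` has `|S| ≥ 5`**.

THEOREM (informal; complete given (O1)–(O4) of `Census/DihedralFourCoreLattice.lean` and Markman's fourfold theorem for the two Weil
orbits).  Let `Z` be ANY abelian variety isogenous to a product of powers of `E₀, E₁, T₀, T₁, B₀, …, B₃`.  If for each `k < 5` ONE algebraic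
class on the carrier of `R_k` has a non-zero component on the eigen-line of `R_k` — a codimension-`2` class on the CM `13`-fold
`E₁ × B₀ × B₂` (Künneth `(1,1,2)`), a codimension-`3` class on the `13`-fold `E₀ × B₂ × B₃` (`(1,3,2)`), a codimension-`2` class on the
`12`-fold `B₁ × B₂` (`(2,2)`), and one codimension-`2` class of Künneth type `(1,3) ⊂ H¹(T) ⊗ H³(B)` on each of the `9`-folds `T₁ × B₁`,
`T₀ × B₃` — then every Hodge class on `Z` is algebraic; fewer than five orbits never suffice (sequel).  Open in print as far as the seat knows.

## References
* [Pohlmann1968] H. Pohlmann, Algebraic cycles on abelian varieties of complex multiplication type, Ann. of Math. 88 (1968), Thm 1.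
* [Milne1999] J. S. Milne, Lefschetz motives and the Tate conjecture, Compositio Math. 117 (1999), Prop. 2.1, p. 54.

## Provenance
Exact oracles (seat folder `work/dic3k/`, copies in `HOME/pub-hodgecm2-b17/dic3k/`): `c62model.py` (model, cross-check with `dic3/gmodel.py`,
family `c6c2_minprofile_families.json[0]`, Markman orbit representatives), `rowcert2.py` (certificate; LLL/Babai syzygy reduction),
`twist62.py` (the `𝔽₄`-invariant), `gen_lean_c62.py` (the three files are generated verbatim from `data_c62model.json`, `twist_c62model.json`).
-/

namespace Summit.HodgeConjecture.CorCM.Census.DodecicC6C2Species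

open Finset

/-! ## The group `ℤ/6 × ℤ/2`, its CM types and the simple factors -/

/-- `G = ℤ/6 × ℤ/2` (additive); the complex conjugation is `c = (0, 1)`. [folklore] -/
abbrev G := ZMod 6 × ZMod 2

/-- The CM types of `(G, c)` as subsets `T ⊆ G`: for every `g` exactly one of `g`, `c + g` lies in `T`. [folklore] -/
def cmTypes : Finset (Finset G) := univ.powerset.filter fun T => ∀ g : G, g ∈ T ↔ ((0, 1) : G) + g ∉ T

/-- The CM types of the simple factors: indices `0, 1` the elliptic curves `E₀, E₁` (induced from the imaginary quadratic subfields
`k₀, k₁`), `2, 3` the threefolds `T₀, T₁` (induced from the sextic CM subfields `K₀, K₁`), `4, …, 7` the four primitive types (sixfolds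
`B₀, …, B₃`). [folklore] -/
def blockType : Fin 8 → Finset G :=
  ![{(0, 0), (1, 0), (2, 0), (3, 0), (4, 0), (5, 0)},
    {(0, 0), (1, 1), (2, 0), (3, 1), (4, 0), (5, 1)},
    {(0, 0), (1, 0), (2, 0), (3, 1), (4, 1), (5, 1)},
    {(0, 0), (1, 0), (2, 1), (3, 0), (4, 0), (5, 1)},
    {(0, 0), (1, 0), (2, 0), (3, 0), (4, 0), (5, 1)},
    {(0, 0), (1, 0), (2, 0), (3, 0), (4, 1), (5, 1)},
    {(0, 0), (1, 0), (2, 0), (3, 1), (4, 0), (5, 1)},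
    {(0, 0), (1, 0), (2, 1), (3, 0), (4, 1), (5, 1)}]

/-- The stabilisers (translation subgroups fixing the block types): `Gal(F/k₀)`, `Gal(F/k₁)`, `Gal(F/K₀)`, `Gal(F/K₁)`, trivial. [folklore] -/
def stab : Fin 8 → Finset G :=
  ![{(0, 0), (1, 0), (2, 0), (3, 0), (4, 0), (5, 0)},
    {(0, 0), (1, 1), (2, 0), (3, 1), (4, 0), (5, 1)},
    {(0, 0), (3, 1)},
    {(0, 0), (3, 0)},
    {(0, 0)},
    {(0, 0)},
    {(0, 0)},
    {(0, 0)}]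

set_option maxRecDepth 20000 in
/-- **Types census.**  `(G, c)` has exactly `64` CM types, exactly the translates of the eight block types; stabilisers `stab`; orbit sizes
`2, 2, 6, 6, 12, 12, 12, 12` (sum `64`: the eight simple factors are pairwise non-isogenous and exhaust the simple CM abelian varieties split
by `F`; dimensions `12/(2·|stab|) = 1, 1, 3, 3, 6, 6, 6, 6`). [folklore] -/
theorem types_census : cmTypes.card = 64 ∧
    cmTypes = (univ ×ˢ (univ : Finset (Fin 8))).image (fun p => (blockType p.2).image (fun t => t + p.1)) ∧
    (∀ b : Fin 8, (univ.filter fun g : G => (blockType b).image (fun t => t + g) = blockType b) = stab b) ∧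
    (∀ b : Fin 8, (univ.image fun g : G => (blockType b).image (fun t => t + g)).card = (![2, 2, 6, 6, 12, 12, 12, 12] : Fin 8 → ℕ) b) := by
  refine ⟨by decide +kernel, by decide +kernel, by decide +kernel, by decide +kernel⟩

/-! ## Labels, the Galois action, the total type -/

/-- Labels of the CM eigenvectors: `e j u` (`u ∈ ℤ/2 = Hom(k_j, ℚ̄)`), `t j u` (`u ∈ ℤ/6 = Hom(K_j, ℚ̄)`), `q j g` (`g ∈ G = Hom(F, ℚ̄)`);
`64 = 2·2 + 2·6 + 4·12`. [folklore] -/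
abbrev Pt := (Fin 2 × ZMod 2) ⊕ ((Fin 2 × ZMod 6) ⊕ (Fin 4 × G))

/-- `e j u`: eigen-label `u` of the elliptic curve `E_j`. [folklore] -/
abbrev e (j : Fin 2) (u : ZMod 2) : Pt := Sum.inl (j, u)

/-- `t j u`: eigen-label `u` of the threefold `T_j`. [folklore] -/
abbrev t (j : Fin 2) (u : ZMod 6) : Pt := Sum.inr (Sum.inl (j, u))

/-- `q j g`: eigen-label `g` of the sixfold `B_j`. [folklore] -/
abbrev q (j : Fin 4) (g : G) : Pt := Sum.inr (Sum.inr (j, g))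

/-- `DecidableEq` of the label type, synthesised once (the nested sum exceeds the default instance size otherwise). [folklore] -/
instance instDecidableEqPt : DecidableEq Pt := inferInstance

/-- `Fintype` of the label type, synthesised once. [folklore] -/
instance instFintypePt : Fintype Pt := inferInstance

/-- The block of a label (`0,1` = `E₀,E₁`; `2,3` = `T₀,T₁`; `4,…,7` = `B₀,…,B₃`). [folklore] -/
def blockOf : Pt → Fin 8
  | Sum.inl (j, _) => ⟨j.val, by omega⟩
  | Sum.inr (Sum.inl (j, _)) => ⟨j.val + 2, by omega⟩
  | Sum.inr (Sum.inr (j, _)) => ⟨j.val + 4, by omega⟩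

/-- The quotient maps `G → G/Gal(F/k_j) ≅ ℤ/2`: `(a,b) ↦ b` (`j = 0`), `(a,b) ↦ a + b mod 2` (`j = 1`). [folklore] -/
def epsE (j : Fin 2) (g : G) : ZMod 2 := if j = 0 then g.2 else (g.1.val : ZMod 2) + g.2

/-- The quotient maps `G → G/Gal(F/K_j) ≅ ℤ/6`: `(a,b) ↦ a + 3b` (`j = 0`, kernel `⟨(3,1)⟩`), `(a,b) ↦ 2a + 3b` (`j = 1`, kernel `⟨(3,0)⟩`). [folklore] -/
def epsT (j : Fin 2) (g : G) : ZMod 6 := if j = 0 then g.1 + 3 * (g.2.val : ZMod 6) else 2 * g.1 + 3 * (g.2.val : ZMod 6)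

/-- `G` acts on the labels by translation through the quotient maps (Galois conjugation of eigenvectors). [folklore] -/
def act (g : G) : Pt → Pt
  | Sum.inl (j, u) => Sum.inl (j, epsE j g + u)
  | Sum.inr (Sum.inl (j, u)) => Sum.inr (Sum.inl (j, epsT j g + u))
  | Sum.inr (Sum.inr (j, h)) => Sum.inr (Sum.inr (j, g + h))

/-- The total CM type `Φ` (labels of Hodge type `(1,0)`), block by block (`labels_census`). [folklore] -/
def phi : Finset Pt := {e 0 0, e 1 0, t 0 0, t 0 1, t 0 2, t 1 0, t 1 1, t 1 2, q 0 (0, 0), q 0 (1, 0), q 0 (2, 0), q 0 (3, 0), q 0 (4, 0), q 0 (5, 1),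
  q 1 (0, 0), q 1 (1, 0), q 1 (2, 0), q 1 (3, 0), q 1 (4, 1), q 1 (5, 1), q 2 (0, 0), q 2 (1, 0), q 2 (2, 0),
  q 2 (3, 1), q 2 (4, 0), q 2 (5, 1), q 3 (0, 0), q 3 (1, 0), q 3 (2, 1), q 3 (3, 0), q 3 (4, 1), q 3 (5, 1)}

set_option maxRecDepth 20000 in
/-- `Φ` is a CM type for `c = (0,1)`, and `act` is an action (closed sanity check). [folklore] -/
theorem sanity : (∀ x : Pt, x ∈ phi ↔ act (0, 1) x ∉ phi) ∧ (∀ g h : G, ∀ x : Pt, act (g + h) x = act g (act h x)) ∧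
    (∀ x : Pt, act 0 x = x) := by
  refine ⟨by decide +kernel, by decide +kernel, by decide +kernel⟩

set_option maxRecDepth 20000 in
/-- **Labels census**: `epsE j`, `epsT j` are homomorphisms with kernels `stab j`, `stab (j+2)` (so the label sets ARE the coset spaces
`G/Gal(F/k_j)`, `G/Gal(F/K_j)` with the induced action), and `Φ` is induced by the block types. [folklore] -/
theorem labels_census : (∀ j : Fin 2, ∀ g h : G, epsE j (g + h) = epsE j g + epsE j h) ∧ (∀ j : Fin 2, ∀ g h : G, epsT j (g + h) = epsT j g + epsT j h) ∧
    (∀ j : Fin 2, (univ.filter fun g : G => epsE j g = 0) = stab (blockOf (e j 0))) ∧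
    (∀ j : Fin 2, (univ.filter fun g : G => epsT j g = 0) = stab (blockOf (t j 0))) ∧
    (∀ j : Fin 2, ∀ g : G, e j (epsE j g) ∈ phi ↔ g ∈ blockType (blockOf (e j 0))) ∧
    (∀ j : Fin 2, ∀ g : G, t j (epsT j g) ∈ phi ↔ g ∈ blockType (blockOf (t j 0))) ∧
    (∀ j : Fin 4, ∀ g : G, q j g ∈ phi ↔ g ∈ blockType (blockOf (q j 0))) := by
  refine ⟨by decide +kernel, by decide +kernel, by decide +kernel, by decide +kernel, by decide +kernel, by decide +kernel,
    by decide +kernel⟩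

/-! ## Pohlmann's Hodge forms and the Hodge lattice -/

/-- Pohlmann's Hodge functional of `g ∈ G` on integer exponent vectors: `Σ_x (2[g·x ∈ Φ] − 1) m_x`. [cite: Pohlmann1968, Thm 1] -/
def hodgeForm (g : G) (m : Pt → ℤ) : ℤ := ∑ x : Pt, (if act g x ∈ phi then m x else -m x)

/-- `Φ` on the labels `e j u` as a Boolean table (kernel-fast). [folklore] -/
def tE : Fin 2 → Fin 2 → Bool := ![![true, false], ![true, false]]

/-- `Φ` on the labels `t j u`. [folklore] -/
def tT : Fin 2 → Fin 6 → Bool := ![![true, true, true, false, false, false], ![true, true, true, false, false, false]]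

/-- `Φ` on the labels `q j (a, b)`. [folklore] -/
def tB : Fin 4 → Fin 6 → Fin 2 → Bool :=
  ![![![true, false],
    ![true, false],
    ![true, false],
    ![true, false],
    ![true, false],
    ![false, true]],
    ![![true, false],
    ![true, false],
    ![true, false],
    ![true, false],
    ![false, true],
    ![false, true]],
    ![![true, false],
    ![true, false],
    ![true, false],
    ![false, true],
    ![true, false],
    ![false, true]],
    ![![true, false],
    ![true, false],
    ![false, true],
    ![true, false],
    ![false, true],
    ![false, true]]]

/-- Boolean membership in `Φ` (kernel-fast twin of `· ∈ phi`, see `inPhi_iff`). [folklore] -/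
def inPhi : Pt → Bool
  | Sum.inl (j, u) => tE j u
  | Sum.inr (Sum.inl (j, u)) => tT j u
  | Sum.inr (Sum.inr (j, (g₁, g₂))) => tB j g₁ g₂

/-- `inPhi` decides membership in `Φ`. [folklore] -/
theorem inPhi_iff : ∀ x : Pt, inPhi x = true ↔ x ∈ phi := by decide

/-- The coefficient vector `(2[g·x ∈ Φ] − 1)_x ∈ {±1}^{64}` of Pohlmann's form `hodgeForm g`. [cite: Pohlmann1968, Thm 1] -/
def hodgeVec (g : G) (x : Pt) : ℤ := if inPhi (act g x) then 1 else -1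

/-- `hodgeVec` in terms of `Φ`. [folklore] -/
theorem hodgeVec_apply (g : G) (x : Pt) : hodgeVec g x = if act g x ∈ phi then 1 else -1 := by
  unfold hodgeVec
  by_cases h : act g x ∈ phi
  · simp [h, (inPhi_iff (act g x)).mpr h]
  · have h' : inPhi (act g x) ≠ true := fun h'' => h ((inPhi_iff _).mp h'')
    simp [h, h']

/-- Pohlmann's form is the dot product with its coefficient vector. [folklore] -/
theorem hodgeForm_eq (g : G) (m : Pt → ℤ) : hodgeForm g m = hodgeVec g ⬝ᵥ m := by
  unfold hodgeForm dotProduct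
  refine Finset.sum_congr rfl fun x _ => ?_
  rw [hodgeVec_apply]
  by_cases hx : act g x ∈ phi <;> simp [hx]

/-- **The Hodge lattice** `H ⊂ ℤ^{64}` of the whole `F`-slice (rank `58` by the oracle). [cite: Pohlmann1968, Thm 1] -/
def hodgeLattice : Submodule ℤ (Pt → ℤ) where
  carrier := {m | ∀ g : G, hodgeVec g ⬝ᵥ m = 0}
  zero_mem' := by intro g; simp
  add_mem' := by
    intro m m' hm hm' g
    rw [dotProduct_add, hm g, hm' g, add_zero]
  smul_mem' := by
    intro c m hm g
    rw [dotProduct_smul, hm g, smul_zero]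

/-- Membership in the Hodge lattice = vanishing of all Pohlmann forms. [folklore] -/
theorem mem_hodgeLattice (m : Pt → ℤ) : m ∈ hodgeLattice ↔ ∀ g : G, hodgeForm g m = 0 := by
  simp only [hodgeForm_eq]; rfl

/-- The conjugate pair through a label (a divisor-class monomial `e_x ∧ e_{cx}`). [folklore] -/
def pairVec (x : Pt) (y : Pt) : ℤ := if y = x ∨ y = act (0, 1) x then 1 else 0

/-- The divisor sublattice `P = ℤ⟨32 conjugate pairs⟩`. [folklore] -/
def pairs : Submodule ℤ (Pt → ℤ) := Submodule.span ℤ (Set.range pairVec)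

/-- Galois translate of an exponent vector: `(g·v)(y) = v(y − g)`. [folklore] -/
def transl (g : G) (v : Pt → ℤ) (y : Pt) : ℤ := v (act (-g) y)

/-- The two WEIL ORBITS of dimension `≤ 5`: the `k₁`-Weil plane of the fourfold `E₁ × T₀` and the `k₀`-Weil plane of `E₀ × T₁`
(Künneth `(1,3) ⊂ H¹(E) ⊗ H³(T)`; orbits of size `2`; with the pairs they span every Hodge monomial on a carrier of dimension `≤ 5`,
`mk_census` / oracle). [folklore] -/
def mkRep : Fin 2 → Finset Pt :=
  ![{e 1 1, t 0 0, t 0 2, t 0 4},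
    {e 0 1, t 1 0, t 1 2, t 1 4}]

/-- The Weil-orbit monomials as exponent vectors. [folklore] -/
def mkVec (k : Fin 2) (y : Pt) : ℤ := if y ∈ mkRep k then 1 else 0

/-- The "Markman" sublattice `Mk` = translates of the two Weil orbits (classes on CM abelian fourfolds of Weil type). [folklore] -/
def markman : Submodule ℤ (Pt → ℤ) := Submodule.span ℤ (Set.range fun p : G × Fin 2 => transl p.1 (mkVec p.2))

/-- Representatives of the FIVE atom orbits (ORDER12-CARRIERS §5, the first of the 48 lexicographically minimal families, profile
`(13,13,12,9,9)`): `R₀` on `E₁ × B₀ × B₂` (Künneth `(1,1,2)`), `R₁` on `E₀ × B₂ × B₃` (`(1,3,2)`), `R₂` on `B₁ × B₂` (`(2,2)`), `R₃` on `T₁ × B₁`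
(`(1,3)`), `R₄` on `T₀ × B₃` (`(1,3)`); orbits of `12`. [folklore] -/
def orbitRep : Fin 5 → Finset Pt :=
  ![{e 1 1, q 0 (5, 0), q 2 (3, 1), q 2 (5, 1)},
    {e 0 1, q 2 (0, 0), q 2 (3, 0), q 2 (4, 0), q 3 (3, 1), q 3 (5, 1)},
    {q 1 (0, 0), q 1 (4, 0), q 2 (4, 1), q 2 (5, 1)},
    {t 1 1, q 1 (2, 0), q 1 (3, 1), q 1 (4, 0)},
    {t 0 5, q 3 (1, 0), q 3 (2, 0), q 3 (3, 0)}]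

/-- The atom monomials as exponent vectors. [folklore] -/
def atomVec (k : Fin 5) (y : Pt) : ℤ := if y ∈ orbitRep k then 1 else 0

/-- The atom sublattice `A = Σ_{k<5} ℤ[G]·atom_k`. [folklore] -/
def atoms : Submodule ℤ (Pt → ℤ) := Submodule.span ℤ (Set.range fun p : G × Fin 5 => transl p.1 (atomVec p.2))

/-- **Census of the Weil orbits and the atoms**: Künneth types over the eight blocks and orbit sizes. [folklore] -/
theorem atom_census :
    (∀ k : Fin 2, (fun j : Fin 8 => ((mkRep k).filter fun x => blockOf x = j).card) = (![![0, 1, 3, 0, 0, 0, 0, 0], ![1, 0, 0, 3, 0, 0, 0, 0]] : Fin 2 → Fin 8 → ℕ) k) ∧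
    (∀ k : Fin 2, (univ.image fun g : G => (mkRep k).image (act g)).card = 2) ∧
    (∀ k : Fin 5, (fun j : Fin 8 => ((orbitRep k).filter fun x => blockOf x = j).card) = (![![0, 1, 0, 0, 1, 0, 2, 0], ![1, 0, 0, 0, 0, 0, 3, 2], ![0, 0, 0, 0, 0, 2, 2, 0], ![0, 0, 0, 1, 0, 3, 0, 0], ![0, 0, 1, 0, 0, 0, 0, 3]] : Fin 5 → Fin 8 → ℕ) k) ∧
    (∀ k : Fin 5, (univ.image fun g : G => (orbitRep k).image (act g)).card = 12) := by
  refine ⟨by decide, by decide, by decide, by decide⟩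

set_option maxRecDepth 20000 in
/-- Every conjugate pair is a Hodge vector. [folklore] -/
theorem pairVec_hodge : ∀ x : Pt, ∀ g : G, hodgeVec g ⬝ᵥ pairVec x = 0 := by
  decide +kernel

set_option maxRecDepth 20000 in
/-- Every translate of a Weil-orbit monomial is a Hodge vector. [folklore] -/
theorem mk_hodge : ∀ h g : G, ∀ k : Fin 2, hodgeVec g ⬝ᵥ transl h (mkVec k) = 0 := by
  decide +kernel

set_option maxRecDepth 20000 in
/-- Every translate of every atom is a Hodge vector. [folklore] -/
theorem atom_hodge : ∀ h g : G, ∀ k : Fin 5, hodgeVec g ⬝ᵥ transl h (atomVec k) = 0 := by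
  decide +kernel

/-- `P ≤ H`. [folklore] -/
theorem pairs_le : pairs ≤ (hodgeLattice : Submodule ℤ (Pt → ℤ)) :=
  Submodule.span_le.mpr (by rintro _ ⟨x, rfl⟩ g; exact pairVec_hodge x g)

/-- `Mk ≤ H`. [folklore] -/
theorem markman_le : markman ≤ (hodgeLattice : Submodule ℤ (Pt → ℤ)) :=
  Submodule.span_le.mpr (by rintro _ ⟨p, rfl⟩ g; exact mk_hodge p.1 g p.2)

/-- `A ≤ H`. [folklore] -/
theorem atoms_le : atoms ≤ (hodgeLattice : Submodule ℤ (Pt → ℤ)) :=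
  Submodule.span_le.mpr (by rintro _ ⟨p, rfl⟩ g; exact atom_hodge p.1 g p.2)

/-- Translates of atoms are in `A`. [folklore] -/
theorem transl_atomVec_mem (g : G) (k : Fin 5) : transl g (atomVec k) ∈ atoms := Submodule.subset_span ⟨(g, k), rfl⟩

end Summit.HodgeConjecture.CorCM.Census.DodecicC6C2Species
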